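import Literature.Analysis.SpecialFunctions.OblateSpheroidalCompletenessAzimuthal
import HarnessLib

/-!
# The associated-Legendre eigenfunctions in the polar angle `θ`: the ODE and Green's identity

Dafermos–Rodnianski–Shlapentokh-Rothman, arXiv:1402.7034, §5.2.1–§5.2.3: the angular operator of
`ρ² □_g` on Kerr in the coordinates `(t*, r, θ, φ*)` is, on a mode `e^{-iωt} e^{imφ}`,
`-(1/sin θ) ∂_θ(sin θ ∂_θ) + m²/sin²θ` plus bounded terms (tree:
`Kerr.blSigma_mul_coordWave_starChart`, `KerrStarWaveOperator.lean`: `∂_θ² + cot θ ∂_θ +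
(sin θ)⁻² ∂_φ² + a² sin²θ TT + 2aT∂_φ`). To pass from the equation `ρ²□_g ψ = F` to the separated
radial ODE (Prop. 5.2.1) one tests against the angular basis and **integrates by parts in `θ`**.
This file supplies the `θ`-side of that computation for the unperturbed basis functions
`y_{m,k}(θ) = sin^m θ · q_k(cos θ)` (`q_k = assocLegPoly m k`, the tree's orthogonal polynomials of
`AssociatedLegendreHilbertBasis`; `(1-x²)^{m/2} q_k(x)` at `x = cos θ`):

* `thetaFn m q θ = sin θ ^ m * q(cos θ)` and its first two `θ`-derivatives (`hasDerivAt_thetaFn`,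
  `hasDerivAt_sin_mul_thetaDeriv`), all entire in `θ`;
* `thetaFn_ode` (**the associated-Legendre equation in `θ`**): for every real polynomial `q`,
  `-(sin θ · y')' + m² sin^{m-1}θ q(cos θ) = sin^{m+1} θ · (T_m q)(cos θ)`, where
  `T_m = assocLegOp m` is the conjugated operator;
  with `T_m q_k = Λ_{m,k} q_k` (`assocLegOp_assocLegPoly`):
  `-(sin θ · y_{m,k}')' + m² (y_{m,k}/sin θ) = Λ_{m,k} sin θ · y_{m,k}` (`thetaFn_eigen`) — the
  function `y/sin θ = sin^{m-1}θ q(cos θ)` being smooth for `m ≥ 1` and the term absent for `m = 0`;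
* `thetaGreen` (**Green's identity on `[0, π]`**): for a complex test function `h` with
  `h' = dh/dθ` and `w = d/dθ (sin θ · h')` on `[0, π]` (`h'` continuous, `w` integrable),
  `∫_0^π ( -y(θ) w(θ) + m² sin^{m-1}θ q(cos θ) h(θ) ) dθ = ∫_0^π sin^{m+1}θ (T_m q)(cos θ) h(θ) dθ`,
  and for `q = q_k`: `= Λ_{m,k} ∫_0^π sin θ · y_{m,k}(θ) h(θ) dθ` (`thetaGreen_eigen`). All boundary
  terms vanish because of the factor `sin θ` (`sin 0 = sin π = 0`): no behaviour of `h` at the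
  poles is needed;
* `thetaFn_eq_assocLegFn` (`y(θ) = assocLegFn m q (cos θ)` on `[0, π]`) and the substitution rule
  `integral_comp_cos` (`∫_0^π G(cos θ) sin θ dθ = ∫_{-1}^1 G`), linking with `L²([-1, 1])`.

## Mathlib / tree search

Mathlib: `intervalIntegral.integral_mul_deriv_eq_deriv_mul` (integration by parts),
`HasDerivAt.pow/mul/comp`, `Polynomial.hasDerivAt`, `intervalIntegral.integral_comp_smul_deriv'`,
`Real.abs_sin_eq_sqrt_one_sub_cos_sq`; no associated Legendre functions in `θ` (searched
`assocLegendre`, `legendre.*cos`, `spherical.*theta`). Tree: `assocLegOp`, `assocLegPoly`,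
`assocLegLevel`, `assocLegOp_assocLegPoly`, `assocLegFn`, `assocLegHalfWeight`.

## References

* M. Dafermos, I. Rodnianski, Y. Shlapentokh-Rothman, arXiv:1402.7034, §5.2.1 (32), §5.2.3
  (Prop. 5.2.1). [DafermosRodnianskiShlapentokhrothman2014]
* G. E. Andrews, R. Askey, R. Roy, *Special Functions*, CUP 1999, §9.6 (spherical harmonics
  `sin^m θ` times Gegenbauer/Jacobi polynomials of `cos θ`). [AndrewsAskeyRoy1999]
-/

noncomputable section

open MeasureTheory Set Filter Topology Polynomial Real intervalIntegral
open scoped ComplexConjugate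

namespace Literature.Analysis.SpecialFunctions

/-! ### The basis functions in `θ` and their derivatives -/

section Theta

variable (m : ℕ) (q : ℝ[X])

/-- **`y(θ) = sin^m θ · q(cos θ)`** — the weighted polynomial `(1-x²)^{m/2} q(x)` at `x = cos θ`.
[cite: AndrewsAskeyRoy1999, §9.6] -/
def thetaFn (θ : ℝ) : ℝ := sin θ ^ m * q.eval (cos θ)

/-- `y'(θ) = m sin^{m-1}θ cos θ q(cos θ) - sin^{m+1}θ q'(cos θ)`. [folklore] -/
def thetaDeriv (θ : ℝ) : ℝ :=
  m * sin θ ^ (m - 1) * cos θ * q.eval (cos θ) - sin θ ^ (m + 1) * (derivative q).eval (cos θ)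

/-- `(sin θ · y')'(θ)`, expanded. [folklore] -/
def thetaDeriv₂ (θ : ℝ) : ℝ :=
  m * (m * sin θ ^ (m - 1) * cos θ * cos θ * q.eval (cos θ) - sin θ ^ m * sin θ * q.eval (cos θ) -
      sin θ ^ m * cos θ * sin θ * (derivative q).eval (cos θ)) -
    ((m + 2 : ℕ) * sin θ ^ (m + 1) * cos θ * (derivative q).eval (cos θ) -
      sin θ ^ (m + 2) * sin θ * (derivative (derivative q)).eval (cos θ))

/-- Unfolding. [folklore] -/
theorem thetaFn_apply (θ : ℝ) : thetaFn m q θ = sin θ ^ m * q.eval (cos θ) := rfl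

/-- `q(cos θ)` has derivative `-sin θ q'(cos θ)`. [folklore] -/
theorem hasDerivAt_eval_cos (p : ℝ[X]) (θ : ℝ) :
    HasDerivAt (fun θ ↦ p.eval (cos θ)) (-sin θ * (derivative p).eval (cos θ)) θ := by
  exact ((p.hasDerivAt (cos θ)).comp θ (hasDerivAt_cos θ)).congr_deriv (by ring)

/-- **`y' = thetaDeriv`.** [folklore] -/
theorem hasDerivAt_thetaFn (θ : ℝ) : HasDerivAt (thetaFn m q) (thetaDeriv m q θ) θ := by
  have h1 : HasDerivAt (fun θ ↦ sin θ ^ m) (m * sin θ ^ (m - 1) * cos θ) θ :=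
    (hasDerivAt_sin θ).pow m
  have h := h1.mul (hasDerivAt_eval_cos q θ)
  refine h.congr_deriv ?_
  rw [thetaDeriv]
  ring

/-- **`(sin θ · y')' = thetaDeriv₂`.** [folklore] -/
theorem hasDerivAt_sin_mul_thetaDeriv (θ : ℝ) :
    HasDerivAt (fun θ ↦ sin θ * thetaDeriv m q θ) (thetaDeriv₂ m q θ) θ := by
  -- `sin θ · y'(θ) = m sin^m θ cos θ q(cos θ) - sin^{m+2} θ q'(cos θ)`
  have hfun : (fun θ ↦ sin θ * thetaDeriv m q θ) =
      fun θ ↦ m * (sin θ ^ m * cos θ * q.eval (cos θ)) -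
        sin θ ^ (m + 2) * (derivative q).eval (cos θ) := by
    funext θ
    rw [thetaDeriv]
    rcases m with _ | n
    · simp
      ring
    · rw [Nat.add_sub_cancel]
      ring
  rw [hfun]
  have hA : HasDerivAt (fun θ ↦ sin θ ^ m * cos θ * q.eval (cos θ))
      (m * sin θ ^ (m - 1) * cos θ * cos θ * q.eval (cos θ) - sin θ ^ m * sin θ * q.eval (cos θ) -
        sin θ ^ m * cos θ * sin θ * (derivative q).eval (cos θ)) θ := by
    have h := (((hasDerivAt_sin θ).pow m).mul (hasDerivAt_cos θ)).mul (hasDerivAt_eval_cos q θ)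
    refine h.congr_deriv ?_
    simp only [Pi.pow_apply, Pi.mul_apply]
    ring
  have hB : HasDerivAt (fun θ ↦ sin θ ^ (m + 2) * (derivative q).eval (cos θ))
      ((m + 2 : ℕ) * sin θ ^ (m + 1) * cos θ * (derivative q).eval (cos θ) -
        sin θ ^ (m + 2) * sin θ * (derivative (derivative q)).eval (cos θ)) θ := by
    have h := ((hasDerivAt_sin θ).pow (m + 2)).mul (hasDerivAt_eval_cos (derivative q) θ)
    refine h.congr_deriv ?_
    simp only [Pi.pow_apply]
    rw [show m + 2 - 1 = m + 1 from rfl]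
    ring
  exact (hA.const_mul _).sub hB

/-- **The associated-Legendre equation in `θ`** (for an arbitrary polynomial `q`):
`-(sin θ · y')' + m² sin^{m-1}θ q(cos θ) = sin^{m+1}θ (T_m q)(cos θ)`, `T_m = assocLegOp m`
(`= 2(m+1) x q' - (1-x²) q'' + m(m+1) q`).
[cite: DafermosRodnianskiShlapentokhrothman2014, §5.2.1 (32)] -/
theorem thetaFn_ode (θ : ℝ) :
    -thetaDeriv₂ m q θ + (m : ℝ) ^ 2 * sin θ ^ (m - 1) * q.eval (cos θ) =
      sin θ ^ (m + 1) * (assocLegOp m q).eval (cos θ) := by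
  have hsq : (m : ℝ) ^ 2 * sin θ ^ (m - 1) * (1 - cos θ ^ 2) = (m : ℝ) ^ 2 * sin θ ^ (m + 1) := by
    rw [← sin_sq_add_cos_sq θ, add_sub_cancel_right]
    rcases m with _ | n
    · simp
    · rw [Nat.add_sub_cancel]
      ring
  rw [thetaDeriv₂, assocLegOp]
  simp only [eval_add, eval_sub, eval_mul, eval_C, eval_pow, eval_X, Nat.cast_add, Nat.cast_ofNat]
  have hs3 : sin θ ^ (m + 2) * sin θ = sin θ ^ (m + 1) * (1 - cos θ ^ 2) := by
    rw [← sin_sq_add_cos_sq θ]; ring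
  linear_combination (q.eval (cos θ)) * hsq - (derivative (derivative q)).eval (cos θ) * hs3

/-- **The eigen-equation in `θ`** for `q = q_k`:
`-(sin θ · y_{m,k}')' + m² sin^{m-1}θ q_k(cos θ) = Λ_{m,k} sin θ · y_{m,k}(θ)`.
[cite: DafermosRodnianskiShlapentokhrothman2014, §5.2.1 (32)] -/
theorem thetaFn_eigen (k : ℕ) (θ : ℝ) :
    -thetaDeriv₂ m (assocLegPoly m k) θ +
        (m : ℝ) ^ 2 * sin θ ^ (m - 1) * (assocLegPoly m k).eval (cos θ) =
      assocLegLevel m k * (sin θ * thetaFn m (assocLegPoly m k) θ) := by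
  rw [thetaFn_ode, assocLegOp_assocLegPoly, eval_mul, eval_C, thetaFn]
  ring

/-! ### Green's identity on `[0, π]` -/

/-- **Green's identity for `y = sin^m θ q(cos θ)` against a complex test function** on `[0, π]`:
if `h' = dh/dθ` and `w = d/dθ(sin θ · h')` on `[0, π]`, then
`∫_0^π (-y w + m² sin^{m-1}θ q(cos θ) h) dθ = ∫_0^π sin^{m+1}θ (T_m q)(cos θ) h dθ`.
Two integrations by parts; the boundary terms carry the factor `sin θ` and vanish at `0, π`.
[cite: DafermosRodnianskiShlapentokhrothman2014, §5.2.2 (integration by parts in θ)] -/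
theorem thetaGreen {h h' w : ℝ → ℂ} (hh : ∀ θ ∈ uIcc 0 π, HasDerivAt h (h' θ) θ)
    (hw : ∀ θ ∈ uIcc 0 π, HasDerivAt (fun θ ↦ (sin θ : ℂ) * h' θ) (w θ) θ)
    (hh'c : ContinuousOn h' (uIcc 0 π)) (hwi : IntervalIntegrable w volume 0 π) :
    ∫ θ in (0 : ℝ)..π, (-(thetaFn m q θ : ℂ) * w θ +
        (((m : ℝ) ^ 2 * sin θ ^ (m - 1) * q.eval (cos θ) : ℝ) : ℂ) * h θ) =
      ∫ θ in (0 : ℝ)..π, ((sin θ ^ (m + 1) * (assocLegOp m q).eval (cos θ) : ℝ) : ℂ) * h θ := by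
  -- derivatives of the real functions, as complex functions
  have hy : ∀ θ ∈ uIcc 0 π, HasDerivAt (fun θ ↦ (thetaFn m q θ : ℂ)) (thetaDeriv m q θ : ℂ) θ :=
    fun θ _ ↦ (hasDerivAt_thetaFn m q θ).ofReal_comp
  have hsy : ∀ θ ∈ uIcc 0 π, HasDerivAt (fun θ ↦ ((sin θ * thetaDeriv m q θ : ℝ) : ℂ))
      (thetaDeriv₂ m q θ : ℂ) θ :=
    fun θ _ ↦ (hasDerivAt_sin_mul_thetaDeriv m q θ).ofReal_comp
  have hyc : Continuous fun θ ↦ (thetaDeriv m q θ : ℂ) := by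
    refine Complex.continuous_ofReal.comp ?_
    unfold thetaDeriv
    fun_prop
  have hy2c : Continuous fun θ ↦ (thetaDeriv₂ m q θ : ℂ) := by
    refine Complex.continuous_ofReal.comp ?_
    unfold thetaDeriv₂
    fun_prop
  have hhc : ContinuousOn h (uIcc 0 π) :=
    fun θ hθ ↦ (hh θ hθ).continuousAt.continuousWithinAt
  -- first integration by parts: `∫ y w = - ∫ y' sin h'`
  have ibp1 := integral_mul_deriv_eq_deriv_mul hy hw (hyc.intervalIntegrable _ _) hwi
  -- second: `∫ (sin y') h' = - ∫ (sin y')' h`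
  have ibp2 := integral_mul_deriv_eq_deriv_mul hsy hh (hy2c.intervalIntegrable _ _)
    (hh'c.intervalIntegrable)
  simp only [sin_zero, sin_pi, Complex.ofReal_zero, zero_mul, mul_zero, sub_zero,
    zero_sub, Complex.ofReal_mul] at ibp1 ibp2
  -- assemble with the ODE
  have hode : ∀ θ, (((m : ℝ) ^ 2 * sin θ ^ (m - 1) * q.eval (cos θ) : ℝ) : ℂ) =
      ((sin θ ^ (m + 1) * (assocLegOp m q).eval (cos θ) : ℝ) : ℂ) + (thetaDeriv₂ m q θ : ℂ) := by
    intro θ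
    rw [← Complex.ofReal_add, ← thetaFn_ode]
    push_cast
    ring
  have hint1 : IntervalIntegrable (fun θ ↦ -(thetaFn m q θ : ℂ) * w θ) volume 0 π := by
    have hc : Continuous fun θ ↦ -(thetaFn m q θ : ℂ) :=
      (Complex.continuous_ofReal.comp (by unfold thetaFn; fun_prop)).neg
    exact hwi.continuousOn_mul hc.continuousOn
  have hint2 : IntervalIntegrable
      (fun θ ↦ (((m : ℝ) ^ 2 * sin θ ^ (m - 1) * q.eval (cos θ) : ℝ) : ℂ) * h θ) volume 0 π := by
    refine ContinuousOn.intervalIntegrable ?_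
    refine ContinuousOn.mul (Continuous.continuousOn ?_) hhc
    exact Complex.continuous_ofReal.comp (by fun_prop)
  rw [integral_add hint1 hint2]
  calc (∫ θ in (0 : ℝ)..π, -(thetaFn m q θ : ℂ) * w θ) +
        ∫ θ in (0 : ℝ)..π, (((m : ℝ) ^ 2 * sin θ ^ (m - 1) * q.eval (cos θ) : ℝ) : ℂ) * h θ
      = -(∫ θ in (0 : ℝ)..π, (thetaFn m q θ : ℂ) * w θ) +
        ∫ θ in (0 : ℝ)..π, (((sin θ ^ (m + 1) * (assocLegOp m q).eval (cos θ) : ℝ) : ℂ) * h θ +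
          (thetaDeriv₂ m q θ : ℂ) * h θ) := by
        rw [← intervalIntegral.integral_neg]
        congr 1
        · refine integral_congr fun θ _ ↦ ?_
          ring
        · refine integral_congr fun θ _ ↦ ?_
          simp only [hode θ, add_mul]
    _ = -(∫ θ in (0 : ℝ)..π, (thetaFn m q θ : ℂ) * w θ) +
        ((∫ θ in (0 : ℝ)..π, ((sin θ ^ (m + 1) * (assocLegOp m q).eval (cos θ) : ℝ) : ℂ) * h θ) +
          ∫ θ in (0 : ℝ)..π, (thetaDeriv₂ m q θ : ℂ) * h θ) := by
        rw [intervalIntegral.integral_add]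
        · exact ((Complex.continuous_ofReal.comp (by fun_prop)).continuousOn.mul hhc)
            |>.intervalIntegrable
        · exact (hy2c.continuousOn.mul hhc).intervalIntegrable
    _ = _ := by
        have hre : (∫ θ in (0 : ℝ)..π, (thetaDeriv m q θ : ℂ) * ((sin θ : ℂ) * h' θ)) =
            ∫ θ in (0 : ℝ)..π, (sin θ : ℂ) * (thetaDeriv m q θ : ℂ) * h' θ := by
          refine integral_congr fun θ _ ↦ ?_
          ring
        rw [ibp1, hre, ibp2]
        ring

/-- **Green's identity for the eigenfunctions `y_{m,k}`**:
`∫_0^π (-y_{m,k} w + m² sin^{m-1}θ q_k(cos θ) h) dθ = Λ_{m,k} ∫_0^π sin θ · y_{m,k}(θ) h(θ) dθ`.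
[cite: DafermosRodnianskiShlapentokhrothman2014, §5.2.2] -/
theorem thetaGreen_eigen (k : ℕ) {h h' w : ℝ → ℂ} (hh : ∀ θ ∈ uIcc 0 π, HasDerivAt h (h' θ) θ)
    (hw : ∀ θ ∈ uIcc 0 π, HasDerivAt (fun θ ↦ (sin θ : ℂ) * h' θ) (w θ) θ)
    (hh'c : ContinuousOn h' (uIcc 0 π)) (hwi : IntervalIntegrable w volume 0 π) :
    ∫ θ in (0 : ℝ)..π, (-(thetaFn m (assocLegPoly m k) θ : ℂ) * w θ +
        (((m : ℝ) ^ 2 * sin θ ^ (m - 1) * (assocLegPoly m k).eval (cos θ) : ℝ) : ℂ) * h θ) =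
      (assocLegLevel m k : ℂ) *
        ∫ θ in (0 : ℝ)..π, ((sin θ * thetaFn m (assocLegPoly m k) θ : ℝ) : ℂ) * h θ := by
  rw [thetaGreen m (assocLegPoly m k) hh hw hh'c hwi, ← intervalIntegral.integral_const_mul]
  refine integral_congr fun θ _ ↦ ?_
  rw [assocLegOp_assocLegPoly, eval_mul, eval_C, thetaFn]
  push_cast
  ring

/-! ### Link with `L²([-1, 1])`: `x = cos θ` -/

/-- On `[0, π]`, `y(θ) = assocLegFn m q (cos θ)` (as a complex number), i.e.
`sin^m θ q(cos θ) = (√(1 - cos²θ))^m q(cos θ)`. [folklore] -/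
theorem thetaFn_eq_assocLegFn {θ : ℝ} (hθ : θ ∈ Icc 0 π) :
    (thetaFn m q θ : ℂ) = assocLegFn m q (cos θ) := by
  rw [assocLegFn_apply, thetaFn, assocLegHalfWeight, ← abs_sin_eq_sqrt_one_sub_cos_sq,
    abs_of_nonneg (sin_nonneg_of_mem_Icc hθ)]

/-- **The substitution `x = cos θ`**: `∫_0^π G(cos θ) sin θ dθ = ∫_{-1}^1 G(x) dx` for continuous
`G : ℝ → ℂ`. [folklore] -/
theorem integral_comp_cos {G : ℝ → ℂ} (hG : Continuous G) :
    ∫ θ in (0 : ℝ)..π, (sin θ : ℂ) * G (cos θ) = ∫ x in (-1 : ℝ)..1, G x := by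
  have h := integral_deriv_smul_comp' (a := 0) (b := π) (f := cos) (f' := fun θ ↦ -sin θ)
    (g := G) (fun θ _ ↦ hasDerivAt_cos θ) (by fun_prop) hG.continuousOn
  simp only [cos_zero, cos_pi, Function.comp_apply] at h
  rw [intervalIntegral.integral_symm (1 : ℝ) (-1), ← h, ← intervalIntegral.integral_neg]
  refine integral_congr fun θ _ ↦ ?_
  simp only [Complex.real_smul, Complex.ofReal_neg, neg_mul, neg_neg]

end Theta

end Literature.Analysis.SpecialFunctions
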